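import Summits.CriticalPhenomena.PercolationContinuityZ3.Theorems.Transplant.PlanarSkeletonFrmFromDefs
import Summits.CriticalPhenomena.PercolationContinuityZ3.Theorems.Transplant.SkelFrmFromBChoiceCreepY3
import Summits.CriticalPhenomena.PercolationContinuityZ3.Theorems.Transplant.SkelFrmBChoiceCreepY3
import HarnessLib
import Summits.CriticalPhenomena.PercolationContinuityZ3.Theorems.Transplant.SkelFrmBChoiceRootReadWidthY
/-!
# U-WAVE PORT (RULING D-U, lead g21 2026-08-26; WAVE-U-MANIFEST v3.0 row «SkelFrmBChoiceRootReadWidthY» ↦ «SkelFrmFromBChoiceRootReadWidthY») of the tree module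
# `Transplant/SkelFrmBChoiceRootReadWidthY` onto the carrier `PlanarSkeletonFrmFrom` (frames only, cylinders connected from width `ℓ₀` on)

ORIGINAL TITLE: N2 (frames-only node `SamePDropOfSkeletonFrm₁`, OPEN) — (ζ″) ledger, (R) column input: **THE x-READING OF THE (C) y′ ARRIVAL BOX IS NARROW, AND HOW A WIDENED

builds on p205010 (kernel theorem, internal audit signed; external expert review pending) — nothing in this file uses p205010; NOTHING is claimed about the
OPEN node U `SamePDropOfSkeletonFrmFrom₁` (nor U_s / the end state).  Lane `prim-bschramm`, seat `prim-hp-8 gen 53 (U-wave port pen, family P-hp8; tool of record = p3-g26 port_u.py)`; helper file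
(`--supports stmt-CriticalPhenomena-4575 --as helper`).  PORT RULES r1–r4 of RULING D-U: declaration order and proof texts are those of the original,
byte-identical except (i) the carrier token `PlanarSkeletonFrm ↦ PlanarSkeletonFrmFrom` (binders, `namespace`/`end` lines, qualified names of twinned
declarations), (ii) carrier-FREE declarations of the original (φ-level `Skelφ…` blocks and namespace-only arithmetic residents) are NOT re-declared —
this file imports the original and `export`s the twin-free residents (POLICY T / treatment (m1)); residents whose statement mentions a twinned
constant are copied, (iii) every carrier-binding declaration keeps its explicit binder `(Φ : PlanarSkeletonFrmFrom G)` in its own signature (r2).  Docstrings and citations are the original's.  Manifest row idx 150 (level 17; flags verbatim|RESIDENTS(T:0/free:3)); filed by the hp-8 lineage under RULING M-11 (family P-hp8).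
-/

open scoped Classical

noncomputable section

namespace Summit.CriticalPhenomena.PercolationContinuityZ3.Theorems.Transplant

namespace PlanarSkeletonFrmFrom

open PlanarSkeletonFrm.NegB (floorA_bounds)

namespace NegB

open Literature.Probability.Percolation Literature.Probability.LatticeModels SimpleGraph
open Literature.Probability.Percolation.KozmaNitzan.Cells (oth)
open SkelConc (Consts)
open Skelφ (shearUnit kgSL kgSLY kgM₁Y kgM₂Y kgE₁Y kgXY kgCtr2Y kgHw2Y kgA₁Yp kgT₁Y kgTY kgDec₁Y kgDec₂Y dS rdLo rdHi KGYRows)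
open TwoAxis.Para (modulus)
open Neg

/-! ## §1 The tight pure-integer width core -/

export PlanarSkeletonFrm.NegB (creepY_core3_width)

/-! ## §2 The tight width at the tuple of record -/

section WidthY

variable (κ : Consts) {V : Type} [DecidableEq V] [Countable V] {G : SimpleGraph V} [G.LocallyFinite] (Φ : PlanarSkeletonFrmFrom G) (t : V) (p : unitInterval)
  (D : Skelφ.StepI.DataNS V) (g f mk : ℕ)

/-- **THE x-READING OF THE (C) y′ ARRIVAL BOX IS NARROW**: `rdHi₀ − rdLo₀ ≤ 95·s₀ − 1` at the tuple of record (the landed `rd0Y_bounds_3` states the generous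
`≤ 152·s₀ − 3` — exactly the window `2·76·s₀`; its instantiation verbatim over the tight core `creepY_core3_width`). [this work] -/
theorem rd0Y_width_3 (κ : Consts) {V : Type} [DecidableEq V] [Countable V] {G : SimpleGraph V} [G.LocallyFinite] (Φ : PlanarSkeletonFrmFrom G) (t : V) (p : unitInterval) (D : Skelφ.StepI.DataNS V) (g : ℕ) (f : ℕ) (mk : ℕ) (hKq : 5 ≤ Neg.Kq κ) (hN : EqNumL κ Φ t p D g f) (hg : gFloorKG κ Φ t p D mk ≤ g) (hg2 : 40 * Neg.K κ * KS0.R'0 κ Φ t p D mk ≤ g) :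
    rdHi (Aof κ) (nL κ Φ t p D g f) (hL κ Φ t p D g f) (vL κ Φ t p D g f) (vβL κ Φ t p D g f) (prFA κ Φ t p D g f).c₀ (prFA κ Φ t p D g f).c₁ (prFA κ Φ t p D g f).D (arrLoY3 κ Φ t p D g f mk) (arrHiY3 κ Φ t p D g f mk) 0 - rdLo (Aof κ) (nL κ Φ t p D g f) (hL κ Φ t p D g f) (vL κ Φ t p D g f) (vβL κ Φ t p D g f) (prFA κ Φ t p D g f).c₀ (prFA κ Φ t p D g f).c₁ (prFA κ Φ t p D g f).D (arrLoY3 κ Φ t p D g f mk) (arrHiY3 κ Φ t p D g f mk) 0 ≤ 95 * (((fcellsA κ Φ t p D g f).s 0 : ℕ) : ℤ) - 1 := by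
  -- the tuple's facts
  obtain ⟨hsc0, -, hn1, hA0, hDp, hm, -, -, hkq, -⟩ := hsc_Q κ Φ t p D g f hN
  obtain ⟨hnR', hs40, hbig, hR1, -, -⟩ := valsQ_floor κ Φ t p D g f mk hN hg hg2
  have hUs := UsL_le_modulus κ Φ t p D g f hN
  have hNle : (((kgNYv0 κ Φ t p D g f mk (qxYQ4 κ Φ t p D g f) (WxYQ4 κ Φ t p D g f)) : ℕ) : ℤ) ≤ 21 * (((Neg.K κ : ℕ) : ℤ)) + 2 := by exact_mod_cast kgNYv0_le κ Φ t p D g f mk (qxYQ4 κ Φ t p D g f) (WxYQ4 κ Φ t p D g f) hN hg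
  have H := kgYRows0_of κ Φ t p D g f mk (qxYQ4 κ Φ t p D g f) (WxYQ4 κ Φ t p D g f) hN hg
  obtain ⟨-, hE2, hE3⟩ := H.kgE₁Y_spec (kgNYv0 κ Φ t p D g f mk (qxYQ4 κ Φ t p D g f) (WxYQ4 κ Φ t p D g f))
  have hv := hN.v_le
  have hd1eq := (dec₁Y_eq_Q κ Φ t p D g f mk).1
  obtain ⟨ha1lo, ha1hi⟩ := a1Y_bounds_3 κ Φ t p D g f mk hKq hN hg hg2 (kgNYv0 κ Φ t p D g f mk (qxYQ4 κ Φ t p D g f) (WxYQ4 κ Φ t p D g f)) hNle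
  obtain ⟨ha2lo, ha2hi⟩ := a2Y_le_3 κ Φ t p D g f mk hKq hN hg hg2 (kgNYv0 κ Φ t p D g f mk (qxYQ4 κ Φ t p D g f) (WxYQ4 κ Φ t p D g f)) hNle
  obtain ⟨hXY0, hXYle⟩ := XY_le_3 κ Φ t p D g f mk hKq hN hg hg2 (kgNYv0 κ Φ t p D g f mk (qxYQ4 κ Φ t p D g f) (WxYQ4 κ Φ t p D g f)) hNle
  have hCeq := kgCtr2Y_eq_zero H (kgNYv0 κ Φ t p D g f mk (qxYQ4 κ Φ t p D g f) (WxYQ4 κ Φ t p D g f))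
  have hHeq := kgHw2Y_eq_zero (nL κ Φ t p D g f) (ℓL κ Φ t p D g f) (hL κ Φ t p D g f) (vL κ Φ t p D g f) (kgR κ Φ t p D mk) (kgqY κ Φ t p D g f (qxYQ4 κ Φ t p D g f)) (kgWY κ Φ t p D g f (WxYQ4 κ Φ t p D g f)) (kgNYv0 κ Φ t p D g f mk (qxYQ4 κ Φ t p D g f) (WxYQ4 κ Φ t p D g f))
  have hP0 := kgSL_le_natDiv κ Φ t p D g f hN
  have hP1 := Skelφ.natDiv_le_kgSLY hn1 (ℓL κ Φ t p D g f) (hL κ Φ t p D g f)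
  have hP0nat : (((nL κ Φ t p D g f) * (ℓL κ Φ t p D g f) / (shearUnit (nL κ Φ t p D g f) (hL κ Φ t p D g f)) : ℕ) : ℤ) = (((nL κ Φ t p D g f) : ℕ) : ℤ) * (ℓL κ Φ t p D g f) / ((shearUnit (nL κ Φ t p D g f) (hL κ Φ t p D g f)) : ℕ) := by push_cast; rfl
  rw [hP0nat] at hP0 hP1
  rw [kgSLY_eq_kgSL] at hP1
  have h80 : 80 ≤ Neg.K κ := by have := Neg.K_eq κ; omega
  have hK80 : (80 : ℤ) ≤ (((Neg.K κ : ℕ) : ℤ)) := by exact_mod_cast h80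
  have hRR : ((KS0.R'0 κ Φ t p D mk : ℕ) : ℤ) = (((kgR κ Φ t p D mk) : ℕ) : ℤ) := rfl
  rw [hRR] at hnR' hR1 hs40
  have hR0 : (0 : ℤ) ≤ (((kgR κ Φ t p D mk) : ℕ) : ℤ) := by linarith
  have hn0 : (0 : ℤ) < (((nL κ Φ t p D g f) : ℕ) : ℤ) := by exact_mod_cast hn1
  have hn1z : (1 : ℤ) ≤ (((nL κ Φ t p D g f) : ℕ) : ℤ) := by exact_mod_cast hn1
  have hA1 : 1 ≤ Aof κ := by linarith
  have hs0one : (1 : ℤ) ≤ ((((fcellsA κ Φ t p D g f).s 0 : ℕ) : ℤ)) := by exact_mod_cast (fcellsA κ Φ t p D g f).hs 0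
  have hs0p : (0 : ℤ) < ((((fcellsA κ Φ t p D g f).s 0 : ℕ) : ℤ)) := by linarith
  -- `Δ ≤ nℓ ≤ U·sL + 2U − 2`, `n ≤ U`
  have hmod := (Skelφ.NegPrm.modulus_vβOf hn1 (hL κ Φ t p D g f) (ℓL κ Φ t p D g f) (vL κ Φ t p D g f)).2
  have hvβ : vβL κ Φ t p D g f = Skelφ.NegPrm.vβOf (nL κ Φ t p D g f) (hL κ Φ t p D g f) (ℓL κ Φ t p D g f) (vL κ Φ t p D g f) := rfl
  rw [← hvβ] at hmod
  have hU : (0 : ℤ) < ((shearUnit (nL κ Φ t p D g f) (hL κ Φ t p D g f)) : ℕ) := Skelφ.shearUnit_pos hn1 _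
  have hUn : (((nL κ Φ t p D g f) : ℕ) : ℤ) ≤ ((shearUnit (nL κ Φ t p D g f) (hL κ Φ t p D g f)) : ℕ) := by rw [shearUnit_cast]; linarith [abs_nonneg (hL κ Φ t p D g f)]
  have hΔU : (modulus (nL κ Φ t p D g f) (hL κ Φ t p D g f) (vL κ Φ t p D g f) (vβL κ Φ t p D g f)) ≤ (((shearUnit (nL κ Φ t p D g f) (hL κ Φ t p D g f)) : ℕ) : ℤ) * (kgSL (nL κ Φ t p D g f) (ℓL κ Φ t p D g f) (hL κ Φ t p D g f)) + 2 * (((shearUnit (nL κ Φ t p D g f) (hL κ Φ t p D g f)) : ℕ) : ℤ) := by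
    have hfl := Int.lt_mul_ediv_self_add (x := (((nL κ Φ t p D g f) : ℕ) : ℤ) * (ℓL κ Φ t p D g f) - ((shearUnit (nL κ Φ t p D g f) (hL κ Φ t p D g f)) : ℕ) + 1) hU
    unfold Skelφ.kgSL; linarith
  -- `c₀′·A·Δ = s₀·D`
  have hr0 : ((((fcellsA κ Φ t p D g f).r 0 : ℕ) : ℤ)) = 40 * ((Neg.Kq κ : ℕ) : ℤ) * ((((fcellsA κ Φ t p D g f).s 0 : ℕ) : ℤ)) := by
    rw [PCells2.r_eq, show ((fcellsA κ Φ t p D g f).K : ℤ) = Neg.K κ by exact_mod_cast (fcellsA_K κ Φ t p D g f).1,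
      show (((Neg.K κ : ℕ) : ℤ)) = 40 * ((Neg.Kq κ : ℕ) : ℤ) by exact_mod_cast Neg.K_eq κ]
  have e0 : (prFA κ Φ t p D g f).c₀ * Aof κ * (modulus (nL κ Φ t p D g f) (hL κ Φ t p D g f) (vL κ Φ t p D g f) (vβL κ Φ t p D g f)) = ((((fcellsA κ Φ t p D g f).s 0 : ℕ) : ℤ)) * (prFA κ Φ t p D g f).D := by
    rw [hr0] at hsc0
    have h' : (40 * ((Neg.Kq κ : ℕ) : ℤ)) * ((prFA κ Φ t p D g f).c₀ * Aof κ * (modulus (nL κ Φ t p D g f) (hL κ Φ t p D g f) (vL κ Φ t p D g f) (vβL κ Φ t p D g f))) = (40 * ((Neg.Kq κ : ℕ) : ℤ)) * (((((fcellsA κ Φ t p D g f).s 0 : ℕ) : ℤ)) * (prFA κ Φ t p D g f).D) := by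
      linear_combination hsc0
    have h40 : (40 * ((Neg.Kq κ : ℕ) : ℤ)) ≠ 0 := by positivity
    exact mul_left_cancel₀ h40 h'
  -- the box rows and the `/2` facts
  obtain ⟨elo0, ehi0, elo1, ehi1⟩ := arrY3_apply κ Φ t p D g f mk
  have hbox : kgCtr2Y (nL κ Φ t p D g f) (vL κ Φ t p D g f) (kgR κ Φ t p D mk) 0 (kgWY κ Φ t p D g f (WxYQ4 κ Φ t p D g f)) (kgNYv0 κ Φ t p D g f mk (qxYQ4 κ Φ t p D g f) (WxYQ4 κ Φ t p D g f)) - kgHw2Y (nL κ Φ t p D g f) (ℓL κ Φ t p D g f) (hL κ Φ t p D g f) (vL κ Φ t p D g f) (kgR κ Φ t p D mk) 0 (kgqY κ Φ t p D g f (qxYQ4 κ Φ t p D g f)) (kgWY κ Φ t p D g f (WxYQ4 κ Φ t p D g f)) (kgNYv0 κ Φ t p D g f mk (qxYQ4 κ Φ t p D g f) (WxYQ4 κ Φ t p D g f)) ≤ 2 * arrLoY3 κ Φ t p D g f mk 0 ∧ 2 * arrLoY3 κ Φ t p D g f mk 0 ≤ kgCtr2Y (nL κ Φ t p D g f) (vL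 κ Φ t p D g f) (kgR κ Φ t p D mk) 0 (kgWY κ Φ t p D g f (WxYQ4 κ Φ t p D g f)) (kgNYv0 κ Φ t p D g f mk (qxYQ4 κ Φ t p D g f) (WxYQ4 κ Φ t p D g f)) - kgHw2Y (nL κ Φ t p D g f) (ℓL κ Φ t p D g f) (hL κ Φ t p D g f) (vL κ Φ t p D g f) (kgR κ Φ t p D mk) 0 (kgqY κ Φ t p D g f (qxYQ4 κ Φ t p D g f)) (kgWY κ Φ t p D g f (WxYQ4 κ Φ t p D g f)) (kgNYv0 κ Φ t p D g f mk (qxYQ4 κ Φ t p D g f) (WxYQ4 κ Φ t p D g f)) + 1 ∧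
      2 * arrHiY3 κ Φ t p D g f mk 0 ≤ kgCtr2Y (nL κ Φ t p D g f) (vL κ Φ t p D g f) (kgR κ Φ t p D mk) 0 (kgWY κ Φ t p D g f (WxYQ4 κ Φ t p D g f)) (kgNYv0 κ Φ t p D g f mk (qxYQ4 κ Φ t p D g f) (WxYQ4 κ Φ t p D g f)) + kgHw2Y (nL κ Φ t p D g f) (ℓL κ Φ t p D g f) (hL κ Φ t p D g f) (vL κ Φ t p D g f) (kgR κ Φ t p D mk) 0 (kgqY κ Φ t p D g f (qxYQ4 κ Φ t p D g f)) (kgWY κ Φ t p D g f (WxYQ4 κ Φ t p D g f)) (kgNYv0 κ Φ t p D g f mk (qxYQ4 κ Φ t p D g f) (WxYQ4 κ Φ t p D g f)) ∧ kgCtr2Y (nL κ Φ t p D g f) (vL κ Φ t p D g f) (kgR κ Φ t p D mk) 0 (kgWY κ Φ t p D g f (WxYQ4 κ Φ t p D g f)) (kgNYv0 κ Φ t p D g f mk (qxYQ4 κ Φ t p D g f) (WxYQ4 κ Φ t p D g f)) + kgHw2Y (nL κ Φ t p D g f) (ℓL κ Φ t p D g f) (hL κ Φ t p D g f) (vL κ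 Φ t p D g f) (kgR κ Φ t p D mk) 0 (kgqY κ Φ t p D g f (qxYQ4 κ Φ t p D g f)) (kgWY κ Φ t p D g f (WxYQ4 κ Φ t p D g f)) (kgNYv0 κ Φ t p D g f mk (qxYQ4 κ Φ t p D g f) (WxYQ4 κ Φ t p D g f)) - 1 ≤ 2 * arrHiY3 κ Φ t p D g f mk 0 := by
    rw [elo0, ehi0]; omega
  have hlo1 : arrLoY3 κ Φ t p D g f mk 1 = ((((kgNYv0 κ Φ t p D g f mk (qxYQ4 κ Φ t p D g f) (WxYQ4 κ Φ t p D g f)) : ℕ) : ℤ) + 1) * (kgSL (nL κ Φ t p D g f) (ℓL κ Φ t p D g f) (hL κ Φ t p D g f)) + kgXY (nL κ Φ t p D g f) (ℓL κ Φ t p D g f) (hL κ Φ t p D g f) (vL κ Φ t p D g f) (kgR κ Φ t p D mk) 0 (kgqY κ Φ t p D g f (qxYQ4 κ Φ t p D g f)) (kgWY κ Φ t p D g f (WxYQ4 κ Φ t p D g f)) (kgNYv0 κ Φ t p D g f mk (qxYQ4 κ Φ t p D g f) (WxYQ4 κ Φ t p D g f)) - (((nL κ Φ t p D g f) : ℕ)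 : ℤ) * (ℓL κ Φ t p D g f) / ((shearUnit (nL κ Φ t p D g f) (hL κ Φ t p D g f)) : ℕ) := by
    rw [elo1, kgSLY_eq_kgSL]; push_cast; ring
  have hT2 : (vL κ Φ t p D g f) * ((((shearUnit (nL κ Φ t p D g f) (hL κ Φ t p D g f)) : ℕ) : ℤ) * arrHiY3 κ Φ t p D g f mk 1 + (((shearUnit (nL κ Φ t p D g f) (hL κ Φ t p D g f)) : ℕ) : ℤ) - 1) = (vL κ Φ t p D g f) * ((((shearUnit (nL κ Φ t p D g f) (hL κ Φ t p D g f)) : ℕ) : ℤ) * arrLoY3 κ Φ t p D g f mk 1) + (vL κ Φ t p D g f) * ((((shearUnit (nL κ Φ t p D g f) (hL κ Φ t p D g f)) : ℕ) : ℤ) * ((((nL κ Φ t p D g f) : ℕ) : ℤ) * (ℓL κ Φ t p D g f) / ((shearUnit (nL κ Φ t p D g f) (hL κ Φ t p D g f)) : ℕ)) + (((shearUnit (nL κ Φ t p D g f) (hL κ Φ t p D g f)) : ℕ) : ℤ) - 1) := by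
    rw [ehi1, elo1]; push_cast; ring
  -- the readings as nested floors
  rw [Skelφ.rdLo_zero, Skelφ.rdHi_zero]
  set Zm := ((modulus (nL κ Φ t p D g f) (hL κ Φ t p D g f) (vL κ Φ t p D g f) (vβL κ Φ t p D g f)) * arrLoY3 κ Φ t p D g f mk 0 - max ((vL κ Φ t p D g f) * ((((shearUnit (nL κ Φ t p D g f) (hL κ Φ t p D g f)) : ℕ) : ℤ) * arrLoY3 κ Φ t p D g f mk 1)) ((vL κ Φ t p D g f) * ((((shearUnit (nL κ Φ t p D g f) (hL κ Φ t p D g f)) : ℕ) : ℤ) * arrHiY3 κ Φ t p D g f mk 1 + (((shearUnit (nL κ Φ t p D g f) (hL κ Φ t p D g f)) : ℕ) : ℤ) - 1))) with hZm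
  set Zp := ((modulus (nL κ Φ t p D g f) (hL κ Φ t p D g f) (vL κ Φ t p D g f) (vβL κ Φ t p D g f)) * arrHiY3 κ Φ t p D g f mk 0 - min ((vL κ Φ t p D g f) * ((((shearUnit (nL κ Φ t p D g f) (hL κ Φ t p D g f)) : ℕ) : ℤ) * arrLoY3 κ Φ t p D g f mk 1)) ((vL κ Φ t p D g f) * ((((shearUnit (nL κ Φ t p D g f) (hL κ Φ t p D g f)) : ℕ) : ℤ) * arrHiY3 κ Φ t p D g f mk 1 + (((shearUnit (nL κ Φ t p D g f) (hL κ Φ t p D g f)) : ℕ) : ℤ) - 1))) with hZp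
  have hqm := Int.mul_ediv_self_le (x := Aof κ * Zm) (ne_of_gt hn0)
  have hqm' := Int.lt_mul_ediv_self_add (x := Aof κ * Zm) hn0
  have hqp := Int.mul_ediv_self_le (x := Aof κ * Zp) (ne_of_gt hn0)
  have hqp' := Int.lt_mul_ediv_self_add (x := Aof κ * Zp) hn0
  have hFm := Int.mul_ediv_self_le (x := (prFA κ Φ t p D g f).c₀ * (Aof κ * Zm / (((nL κ Φ t p D g f) : ℕ) : ℤ))) (ne_of_gt hDp)
  have hFm' := Int.lt_mul_ediv_self_add (x := (prFA κ Φ t p D g f).c₀ * (Aof κ * Zm / (((nL κ Φ t p D g f) : ℕ) : ℤ))) hDp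
  have hFp := Int.mul_ediv_self_le (x := (prFA κ Φ t p D g f).c₀ * (Aof κ * Zp / (((nL κ Φ t p D g f) : ℕ) : ℤ))) (ne_of_gt hDp)
  have hFp' := Int.lt_mul_ediv_self_add (x := (prFA κ Φ t p D g f).c₀ * (Aof κ * Zp / (((nL κ Φ t p D g f) : ℕ) : ℤ))) hDp
  obtain ⟨-, hF2⟩ := floorA_bounds hA1 hn0 hm hs0p hDp e0 hqm hqm' hFm hFm'
  obtain ⟨hF3, -⟩ := floorA_bounds hA1 hn0 hm hs0p hDp e0 hqp hqp' hFp hFp'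
  have hE5 : ((kgE₁Y (nL κ Φ t p D g f) (vL κ Φ t p D g f) (kgR κ Φ t p D mk) 0 (kgWY κ Φ t p D g f (WxYQ4 κ Φ t p D g f)) (kgNYv0 κ Φ t p D g f mk (qxYQ4 κ Φ t p D g f) (WxYQ4 κ Φ t p D g f)) : ℕ) : ℤ) ≤ 5 * (((nL κ Φ t p D g f) : ℕ) : ℤ) := by linarith [abs_nonneg (vL κ Φ t p D g f)]
  have hK100 : (100 : ℤ) ≤ (((Neg.K κ : ℕ) : ℤ)) := by
    have h100 : 100 ≤ Neg.K κ := by have := Neg.K_eq κ; omega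
    exact_mod_cast h100
  exact creepY_core3_width (hn := hn1z) (hUn := hUn) (hUs := hUs) (hΔU := hΔU) (hs := hbig) (hK := hK100) (hR := hR1) (hKR := hs40) (hnR := hnR')
    (hav0 := abs_nonneg _) (havn := hv) (hv1 := le_abs_self _) (hv2 := neg_le_abs _) (hN0 := Nat.cast_nonneg _) (hN := hNle)
    (ha1 := ha1lo) (ha1' := ha1hi) (ha2 := ha2lo) (ha2' := ha2hi) (hE0 := hE2) (hE1 := hE5) (hXY0 := hXY0) (hXY := hXYle)
    (hP0 := hP0) (hP1 := hP1) (hH := hHeq) (hC := hCeq) (hlo0 := hbox.1) (hlo0' := hbox.2.1) (hhi0 := hbox.2.2.1) (hhi0' := hbox.2.2.2)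
    (hlo1 := hlo1) (hG := rfl) (hT₁ := rfl) (hT₂ := hT2) (hAm := hZm) (hAp := hZp) (hs0 := hs0one) (hF2 := hF2) (hF3 := hF3)

end WidthY

/-! ## §3 Widening a box moves the axis-0 readings by whole fine cells -/

section Shift

variable {A : ℤ} {n : ℕ} {h vα vβ c₀' c₁' D : ℤ} {lo hi lo' hi' : Site 2} {e k : ℤ}

export PlanarSkeletonFrm.NegB (rdLo_zero_widen)

export PlanarSkeletonFrm.NegB (rdHi_zero_widen)

end Shift

end NegB

end PlanarSkeletonFrmFrom

end Summit.CriticalPhenomena.PercolationContinuityZ3.Theorems.Transplant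

end
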